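import Literature.Probability.Percolation.SlabCircuitCornerRoutes
import Literature.Probability.Percolation.SlabCircuitCornerDatum
import Literature.Probability.Percolation.SlabRSWGluingRect
import Literature.Probability.Percolation.SlabRSWGluingBound
import HarnessLib

/-!
# Newman–Tassion–Wu 2017, Theorem 3.10 — the located surgery in the top-right corner square

Topic: `Literature/Probability/Percolation`. Seventeenth file of the port of THEOREM 3.10 of
Newman–Tassion–Wu, *Critical percolation and the minimal spanning tree in slabs* (CPAM 70 (2017);
arXiv:1512.09107, pp. 12–14): the map `Φ` of (3.121)–(3.122) in the port's square-ring geometry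
(`SlabCircuitFromCornerLinks.lean`). The gluing datum of the top-right corner is
`Q₁ = (S := domT, R := domT ∪ corR, A := {x = -N}, B := {x = N+n+1}, C := {y = -N})` (`cornerQ₁`,
`SlabCircuitCornerDatum.lean`), so that `Q₁.evAB ∩ {corR crossed} = cornerDom₁` and `Q₁.evCA = cornerLink₁`. For every lattice
configuration of `cornerDom₁ ∖ cornerLink₁` we construct a `GlueData.Surgery` whose cleared set lies
INSIDE THE CORNER SQUARE (every edge off it may carry a bystander) and inside a ball of radius `3`
(`exists_surgery_corner₁`, widths `n ≥ 4`):

* the contact: `Γ = Γ_min^{domT}` crosses the corner square from left to right and the corridor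
  path `κ` crosses it from bottom to top, so they share a planar cell (`planarCrossing_rect` on the
  two extracted segments, `exists_infix_levels`); `x` = the first vertex of `κ` over a cell of `Γ`,
  `z` its cell, `D = cornerSq ∩ (z + B_3)` (a rectangle with at least four rows and columns);
* the port: the vertex of `κ` before its first entry into `D̄` (generic position: the entry vertex
  is on no cell of `Γ`, and the tree's `exists_route` applies), or — when `κ` enters `D̄` only at `x`,
  from below the corner square — the vertex under `x`; then `z` lies on the bottom row and an end
  of `Γ` over `D` can share the cell `z` only at a bottom CORNER of the square, where the routes of
  `SlabCircuitCornerRoutes.lean` take over;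
* `exists_surgery_of_route'`: the tree's `exists_surgery_of_route` with the route required only for
  the actual first/last vertices of `Γ` over `D` (their outer neighbours on `Γ` are off `D̄`).

## Sources

* C. M. Newman, V. Tassion, W. Wu, *Critical percolation and the minimal spanning tree in slabs*,
  Comm. Pure Appl. Math. 70 (2017), arXiv:1512.09107: proof of Theorem 3.10, (3.121)–(3.122)
  ("we now perform a two step gluing procedure in the square regions R₁ and R₂", p. 14), with the
  surgery of the proof of Theorem 3.7, steps (1)–(3) (pp. 9–10) [NewmanTassionWu2017].
-/

noncomputable section

namespace Literature.Probability.Percolation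

open MeasureTheory LatticeModels SimpleGraph

namespace NTW17

variable {k : ℕ}



/-! ## Planar helpers -/

/-- The four cases of planar adjacency, in coordinates. [folklore] -/
private theorem planarAdj_cases {a b : ℤ × ℤ} (h : planarAdj a b) :
    (b.1 = a.1 + 1 ∧ b.2 = a.2) ∨ (b.1 = a.1 - 1 ∧ b.2 = a.2) ∨ (b.1 = a.1 ∧ b.2 = a.2 + 1) ∨
      (b.1 = a.1 ∧ b.2 = a.2 - 1) := by
  rcases h with (h | h) | (h | h) <;> rw [Prod.ext_iff] at h <;> simp only [Prod.fst_add, Prod.snd_add] at h <;> omega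

/-- A lattice neighbour, off the columns of `D`, of a vertex over `D` lies over an adjacent cell at
the same height. [folklore] -/
private theorem adj_out {D : Set (ℤ × ℤ)} {u v : slab 3 k} (hadj : (slabGraph 3 k).Adj u v)
    (hv : planar k v ∈ D) (hu : planar k u ∉ D) : ht u = ht v ∧ planarAdj (planar k u) (planar k v) := by
  rcases (slab_adj_iff u v).1 hadj with h | ⟨hp, -⟩
  · exact h
  · exact absurd (hp ▸ hv) hu

/-- Coordinate functionals are 1-Lipschitz along open steps of a lattice configuration. [folklore] -/
private theorem step_le {ω : BondConfig (slab 3 k)} (hω : ω ⊆ (slabGraph 3 k).edgeSet)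
    {φ : ℤ × ℤ → ℤ} (hφ : ∀ z w, planarAdj z w → φ w ≤ φ z + 1 ∧ φ z ≤ φ w + 1) {a b : slab 3 k}
    (h : s(a, b) ∈ ω ∧ a ≠ b) : φ (planar k b) ≤ φ (planar k a) + 1 ∧ φ (planar k a) ≤ φ (planar k b) + 1 := by
  rcases planar_rel_of_open hω h with h | h
  · rw [h]; omega
  · exact hφ _ _ h

/-! ## Segments of a path between two levels -/

/-- **The segment between two levels.** An open path of a lattice configuration from `φ < c` to
`φ ≥ d` (`c ≤ d`, `φ` a coordinate functional) contains a contiguous piece all of whose vertices have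
`c ≤ φ ≤ d`, starting on `φ = c` and ending on `φ = d`. [cite: NewmanTassionWu2017, Theorem 3.10 (proof, paths restricted to the squares R₁, R₂)] -/
theorem exists_infix_levels {ω : BondConfig (slab 3 k)} (hω : ω ⊆ (slabGraph 3 k).edgeSet)
    {φ : ℤ × ℤ → ℤ} (hφ : ∀ z w, planarAdj z w → φ w ≤ φ z + 1 ∧ φ z ≤ φ w + 1) {c d : ℤ} (hcd : c ≤ d)
    {l : List (slab 3 k)} (hne : l ≠ []) (hl : l.IsChain (fun a b => s(a, b) ∈ ω ∧ a ≠ b))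
    (hhead : φ (planar k (l.head hne)) < c) (hlast : d ≤ φ (planar k (l.getLast hne))) :
    ∃ (l' : List (slab 3 k)) (hne' : l' ≠ []), l' <:+: l ∧ l'.IsChain (fun a b => s(a, b) ∈ ω ∧ a ≠ b) ∧
      (∀ v ∈ l', c ≤ φ (planar k v) ∧ φ (planar k v) ≤ d) ∧
      φ (planar k (l'.head hne')) = c ∧ φ (planar k (l'.getLast hne')) = d := by
  -- after the last vertex below `c`
  obtain ⟨l₁, p, l₂, hsplit, hp, hno⟩ :=
    exists_last_split (p := fun v => φ (planar k v) < c) l ⟨l.head hne, List.head_mem hne, hhead⟩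
  have hl₂ : l₂ ≠ [] := by
    rintro rfl
    have : l.getLast hne = p := by simp [hsplit]
    rw [this] at hlast
    have hp' : φ (planar k p) < c := hp
    omega
  have hch₂ : (p :: l₂).IsChain (fun a b => s(a, b) ∈ ω ∧ a ≠ b) := by
    rw [hsplit] at hl; exact hl.right_of_append
  have hl₂last : l₂.getLast hl₂ = l.getLast hne := by
    simp [hsplit, List.getLast_append_of_ne_nil, List.getLast_cons hl₂]
  have hhead₂ : φ (planar k (l₂.head hl₂)) ≤ c := by
    obtain ⟨q, r, rfl⟩ := List.exists_cons_of_ne_nil hl₂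
    have := (step_le hω hφ (List.isChain_cons_cons.1 hch₂).1).1
    have hp' : φ (planar k p) < c := hp
    simp only [List.head_cons]; omega
  -- up to the first vertex at level `≥ d`
  obtain ⟨m, q, rest, hsplit₂, hq, hnom⟩ :=
    exists_first_split (p := fun v => d ≤ φ (planar k v)) l₂ ⟨l₂.getLast hl₂, List.getLast_mem _, by rw [hl₂last]; exact hlast⟩
  have hq' : d ≤ φ (planar k q) := hq
  refine ⟨m ++ [q], by simp, ?_, ?_, ?_, ?_, ?_⟩
  · refine ⟨l₁ ++ [p], rest, ?_⟩
    rw [hsplit, hsplit₂]; simp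
  · have : (m ++ q :: rest).IsChain (fun a b => s(a, b) ∈ ω ∧ a ≠ b) := by
      rw [← hsplit₂]; exact hch₂.tail
    -- `m ++ [q]` is a prefix of `m ++ q :: rest`
    exact this.infix ⟨[], rest, by simp⟩
  · intro v hv
    have hv₂ : v ∈ l₂ := by
      rw [hsplit₂]
      rcases List.mem_append.1 hv with h | h
      · exact List.mem_append_left _ h
      · rw [List.mem_singleton] at h; subst h; simp
    refine ⟨not_lt.1 (hno v hv₂), ?_⟩
    rcases List.mem_append.1 hv with h | h
    · have := not_le.1 (hnom v h); omega
    · rw [List.mem_singleton] at h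
      subst h
      -- `φ q ≤ d`: `q` follows a vertex of `m` (at level `< d`) or is the head of `l₂` (at level `≤ c`)
      by_cases hm : m = []
      · subst hm
        have : l₂.head hl₂ = v := by simp [hsplit₂]
        rw [this] at hhead₂; omega
      · have hch' : (m ++ v :: rest).IsChain (fun a b => s(a, b) ∈ ω ∧ a ≠ b) := by
          rw [← hsplit₂]; exact hch₂.tail
        have hrel := List.IsChain.rel_getLast_head_of_append hch' hm (by simp)
        simp only [List.head_cons] at hrel
        have h1 := (step_le hω hφ hrel).1
        have h2 := not_le.1 (hnom _ (List.getLast_mem hm))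
        omega
  · -- the head is the head of `l₂`, at level exactly `c`
    have hh : (m ++ [q]).head (by simp) = l₂.head hl₂ := by
      cases m with
      | nil => simp [hsplit₂]
      | cons a t => simp [hsplit₂]
    rw [hh]
    have := not_lt.1 (hno _ (List.head_mem hl₂))
    omega
  · -- the last vertex is `q`, at level exactly `d`
    have hl' : (m ++ [q]).getLast (by simp) = q := by simp
    rw [hl']
    by_cases hm : m = []
    · subst hm
      have : l₂.head hl₂ = q := by simp [hsplit₂]
      rw [this] at hhead₂; omega
    · have hch' : (m ++ q :: rest).IsChain (fun a b => s(a, b) ∈ ω ∧ a ≠ b) := by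
        rw [← hsplit₂]; exact hch₂.tail
      have hrel := List.IsChain.rel_getLast_head_of_append hch' hm (by simp)
      simp only [List.head_cons] at hrel
      have h1 := (step_le hω hφ hrel).1
      have h2 := not_le.1 (hnom _ (List.getLast_mem hm))
      omega

/-! ## The contact cell -/

/-- Lipschitz bounds of the two coordinates. [folklore] -/
private theorem lip_fst : ∀ z w : ℤ × ℤ, planarAdj z w → w.1 ≤ z.1 + 1 ∧ z.1 ≤ w.1 + 1 :=
  fun z w h => by have := abs_sub_le_one_of_planarAdj h; omega
/-- Lipschitz bounds of the two coordinates. [folklore] -/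
private theorem lip_snd : ∀ z w : ℤ × ℤ, planarAdj z w → w.2 ≤ z.2 + 1 ∧ z.2 ≤ w.2 + 1 :=
  fun z w h => by have := abs_sub_le_one_of_planarAdj h; omega

variable {N n : ℕ}

/-- **The contact.** An open crossing of `domT` from the hole's left edge to the outer column and an
open crossing of the corridor `corR` from its bottom row to its top row share a planar cell (their
segments inside the corner square cross it left-right resp. bottom-top).
[cite: NewmanTassionWu2017, Theorem 3.10 (proof, (3.121)–(3.122): "forcing the existence of open paths")] -/
theorem exists_contact_corner₁ (hn : 1 ≤ n) {ω : BondConfig (slab 3 k)} (hω : ω ⊆ (slabGraph 3 k).edgeSet)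
    {γ κ : List (slab 3 k)}
    (hγ : IsOSAP k ω (slabLift k (domT N n)) (slabLift k {z | z.1 = -(N : ℤ)})
      (slabLift k {z | z.1 = (N : ℤ) + n + 1}) γ)
    (hκ : IsOSAP k ω (slabLift k (corR N n)) (slabLift k {z | z.2 = -(N : ℤ)})
      (slabLift k {z | z.2 = (N : ℤ) + n}) κ) :
    ∃ g ∈ γ, ∃ x ∈ κ, planar k g = planar k x := by
  -- the two segments inside the corner square
  obtain ⟨sγ, hsγ, hinfγ, hchγ, hbdγ, hhγ, hlγ⟩ := exists_infix_levels (φ := fun z => z.1) hω lip_fst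
    (show (N : ℤ) + 1 ≤ N + n by omega) hγ.ne_nil hγ.chain
    (by have := hγ.head_mem hγ.ne_nil; simp only [mem_slabLift_iff, Set.mem_setOf_eq] at this; omega)
    (by have := hγ.last_mem hγ.ne_nil; simp only [mem_slabLift_iff, Set.mem_setOf_eq] at this; omega)
  obtain ⟨sκ, hsκ, hinfκ, hchκ, hbdκ, hhκ, hlκ⟩ := exists_infix_levels (φ := fun z => z.2) hω lip_snd
    (show (N : ℤ) + 1 ≤ N + n by omega) hκ.ne_nil hκ.chain
    (by have := hκ.head_mem hκ.ne_nil; simp only [mem_slabLift_iff, Set.mem_setOf_eq] at this; omega)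
    (by have := hκ.last_mem hκ.ne_nil; simp only [mem_slabLift_iff, Set.mem_setOf_eq] at this; omega)
  have hγbox : ∀ z ∈ sγ.map (planar k), z ∈ boxR ((N : ℤ) + 1) ((N : ℤ) + n) ((N : ℤ) + 1) ((N : ℤ) + n) := by
    intro z hz
    obtain ⟨v, hv, rfl⟩ := List.mem_map.1 hz
    have h1 := hbdγ v hv
    have h2 := hγ.subset v (hinfγ.subset hv)
    simp only [mem_slabLift_iff, domT, mem_boxR_iff] at h1 h2 ⊢
    omega
  have hκbox : ∀ z ∈ sκ.map (planar k), z ∈ boxR ((N : ℤ) + 1) ((N : ℤ) + n) ((N : ℤ) + 1) ((N : ℤ) + n) := by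
    intro z hz
    obtain ⟨v, hv, rfl⟩ := List.mem_map.1 hz
    have h1 := hbdκ v hv
    have h2 := hκ.subset v (hinfκ.subset hv)
    simp only [mem_slabLift_iff, corR, mem_boxR_iff] at h1 h2 ⊢
    omega
  have hne₁ : sγ.map (planar k) ≠ [] := by simpa using hsγ
  have hne₂ : sκ.map (planar k) ≠ [] := by simpa using hsκ
  obtain ⟨z, hz₁, hz₂⟩ := planarCrossing_rect (a := (N : ℤ) + 1) (b := (N : ℤ) + n) (c := (N : ℤ) + 1)
    (d := (N : ℤ) + n) (A := {z | z.1 = (N : ℤ) + 1}) (B := {z | z.1 = (N : ℤ) + n})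
    (C := {z | z.2 = (N : ℤ) + 1}) (D := {z | z.2 = (N : ℤ) + n})
    (fun _ h => h) (fun _ h => h) (fun _ h => h) (fun _ h => h)
    _ _ hne₁ hne₂ (isPlanarWalk_map_planar hω hchγ) (isPlanarWalk_map_planar hω hchκ) hγbox hκbox
    (by rw [List.head_map]; exact hhγ) (by rw [List.getLast_map]; exact hlγ)
    (by rw [List.head_map]; exact hhκ) (by rw [List.getLast_map]; exact hlκ)
  obtain ⟨g, hg, rfl⟩ := List.mem_map.1 hz₁
  obtain ⟨x, hx, hxz⟩ := List.mem_map.1 hz₂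
  exact ⟨g, hinfγ.subset hg, x, hinfκ.subset hx, hxz.symm⟩

/-! ## From a route for the actual ends to a surgery -/

section Assemble

variable {Q : GlueData} {ω : BondConfig (slab 3 k)}

/-- **A route plus port data is a surgery** — the tree's `exists_surgery_of_route` with the route
required only for the actual first and last vertices `E₁, E₂` of `Γ` over `D`, which come with their
outer neighbours on `Γ`: lattice neighbours off `D̄`, the one before `E₁` not in `B̄`.
[cite: NewmanTassionWu2017, §3.2 (proof of Theorem 3.7, steps (1)–(3))] -/
theorem exists_surgery_of_route' (hω : ω ⊆ (slabGraph 3 k).edgeSet) (hX : ω ∈ Q.evX k)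
    {D Dt : Set (ℤ × ℤ)} (hDR : D ⊆ Q.R)
    (hDA : ∀ z ∈ D, z ∉ Q.A) (hDB : ∀ z ∈ D, z ∉ Q.B) (hDt : Dt ⊆ D) (hDtS : Dt ⊆ Q.S)
    (htwo : ∃ x ∈ Q.γ k ω, ∃ y ∈ Q.γ k ω, x ≠ y ∧ planar k x ∈ D ∧ planar k y ∈ D)
    {w' q₁ cC : slab 3 k} (hadj : (slabGraph 3 k).Adj w' q₁) (hq₁D : planar k q₁ ∉ D)
    (hcC : cC ∈ slabLift k Q.C) (hσ : ω ∈ openConnIn (slabLift k (Q.R \ D)) q₁ cC)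
    (hroute : ∀ E₁ E₂ pE sE : slab 3 k, E₁ ∈ Q.γ k ω → E₂ ∈ Q.γ k ω → E₁ ≠ E₂ →
      planar k E₁ ∈ D → planar k E₂ ∈ D →
      pE ∈ Q.γ k ω → (slabGraph 3 k).Adj pE E₁ → planar k pE ∉ D → planar k pE ∉ Q.B →
      sE ∈ Q.γ k ω → (slabGraph 3 k).Adj E₂ sE → planar k sE ∉ D →
      ∃ L Br c, RouteSpec k Dt D E₁ E₂ w' L Br c) :
    ∃ sx : Q.Surgery k ω, sx.D = D := by
  have hA : ω ∈ Q.evAB k := Q.evAB_of_evX hX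
  obtain ⟨hγO, -⟩ := Q.γ_spec hA
  obtain ⟨p₀, E₁, mid, E₂, s₀, hγeq, hp₀, hs₀, hp₀D, hs₀D, hE₁D, hE₂D, hE₁₂⟩ :=
    exists_decomp hA hDA hDB htwo
  have hE₁γ : E₁ ∈ Q.γ k ω := by rw [hγeq]; simp
  have hE₂γ : E₂ ∈ Q.γ k ω := by rw [hγeq]; simp
  have hch := isChain_adj_of_isChain_open hω hγO.chain
  -- the outer neighbours
  set pE := p₀.getLast hp₀ with hpE
  set sE := s₀.head hs₀ with hsE
  have hpEγ : pE ∈ Q.γ k ω := by rw [hγeq]; exact List.mem_append_left _ (List.getLast_mem hp₀)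
  have hsEγ : sE ∈ Q.γ k ω := by rw [hγeq]; simp [hsE, List.head_mem]
  have hpE_adj : (slabGraph 3 k).Adj pE E₁ := by
    have h := hch; rw [hγeq] at h
    have := List.IsChain.rel_getLast_head_of_append h hp₀ (by simp)
    simpa using this
  have hsE_adj : (slabGraph 3 k).Adj E₂ sE := by
    have h := hch
    rw [hγeq, show p₀ ++ E₁ :: (mid ++ E₂ :: s₀) = (p₀ ++ E₁ :: (mid ++ [E₂])) ++ s₀ by simp] at h
    have := List.IsChain.rel_getLast_head_of_append h (by simp) hs₀
    simpa [List.getLast_append_of_ne_nil] using this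
  have hpED : planar k pE ∉ D := hp₀D _ (List.getLast_mem hp₀)
  have hsED : planar k sE ∉ D := hs₀D _ (List.head_mem hs₀)
  have hpEB : planar k pE ∉ Q.B := by
    intro hB
    have heq := eq_getLast_of_mem_B hA hpEγ (by rwa [mem_slabLift_iff])
    have hlast : (Q.γ k ω).getLast hγO.ne_nil ∈ E₁ :: (mid ++ E₂ :: s₀) := by
      have : (Q.γ k ω).getLast hγO.ne_nil = (E₁ :: (mid ++ E₂ :: s₀)).getLast (by simp) := by
        simp [hγeq, List.getLast_append_of_ne_nil]
      rw [this]; exact List.getLast_mem _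
    have hnd := hγO.nodup
    rw [hγeq] at hnd
    rw [← heq] at hlast
    exact (List.disjoint_of_nodup_append hnd) (List.getLast_mem hp₀) hlast
  obtain ⟨L, Br, c, spec⟩ := hroute E₁ E₂ pE sE hE₁γ hE₂γ hE₁₂ hE₁D hE₂D hpEγ hpE_adj hpED hpEB
    hsEγ hsE_adj hsED
  set P := L.tail.dropLast with hP
  have hLeq : L = E₁ :: (P ++ [E₂]) := spec.hL.eq_cons_dropLast_concat hE₁₂
  have hPL : ∀ v ∈ P, v ∈ L := fun v hv => by
    rw [hLeq]; exact List.mem_cons_of_mem _ (List.mem_append_left _ hv)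
  have hw'Br : w' ∈ Br := by
    have h1 := spec.hCB.last
    rw [List.getLast?_cons, List.getLast?_eq_some_getLast spec.hBr] at h1
    have : Br.getLast spec.hBr = w' := by simpa using h1
    rw [← this]; exact List.getLast_mem _
  have hq₁CB : q₁ ∉ c :: Br := by
    intro h
    rcases List.mem_cons.1 h with rfl | h
    · exact hq₁D (hDt (spec.hL_sub _ spec.hc))
    · exact hq₁D (spec.hBr_sub _ h)
  have hCBq : SPath ((c :: Br) ++ [q₁]) c q₁ := spec.hCB.concat hadj hq₁CB
  have hc : c ∈ E₁ :: P := by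
    have := spec.hc
    rw [hLeq] at this
    rcases List.mem_cons.1 this with h | h
    · exact List.mem_cons.2 (Or.inl h)
    · rcases List.mem_append.1 h with h | h
      · exact List.mem_cons_of_mem _ h
      · rw [List.mem_singleton] at h
        exact absurd h spec.hcE₂
  refine ⟨⟨D, p₀, E₁, mid, E₂, s₀, P, c, Br, q₁, cC, hDR, hDA, hDB, hγeq, hp₀, hs₀, hp₀D, hs₀D,
    hE₁D, hE₂D,
    fun x hx => hDt (spec.hL_sub x (hPL x hx)),
    fun x hx => hDtS (spec.hL_sub x (hPL x hx)),
    hLeq ▸ spec.hL.chain, hLeq ▸ spec.hL.nodup, hc, spec.hBr_sub, hq₁D,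
    by simpa using hCBq.chain, by simpa using hCBq.nodup,
    fun x hx => hLeq ▸ spec.hBr_L x hx, fun l₁ l₂ y h => ?_, hcC, hσ⟩, rfl⟩
  have hh : (Br ++ [q₁]).head (by simp) = Br.head spec.hBr := by
    simp [List.head_append_of_ne_nil spec.hBr]
  rw [hh]
  exact spec.hfwd l₁ l₂ y (hLeq.trans h) _ (List.head?_eq_some_head spec.hBr ▸ rfl)

end Assemble

/-! ## The surgery in the top-right corner -/

section Corner

variable {N n : ℕ}

/-- **The outer neighbour of a boundary vertex.** If `u ∼ v` with `v` over the box `D` and `u` not,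
then `u` has the height of `v` and lies over the cell across one of the four sides of `D` next to
the cell of `v`, which is on that side. [folklore] -/
private theorem outer_nbr {xL xR rB rT : ℤ} {u v : slab 3 k} (hadj : (slabGraph 3 k).Adj u v)
    (hv : planar k v ∈ boxR xL xR rB rT) (hu : planar k u ∉ boxR xL xR rB rT) :
    ht u = ht v ∧
      (((planar k u).1 = (planar k v).1 + 1 ∧ (planar k u).2 = (planar k v).2 ∧ (planar k v).1 = xR) ∨
        ((planar k u).1 = (planar k v).1 - 1 ∧ (planar k u).2 = (planar k v).2 ∧ (planar k v).1 = xL) ∨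
        ((planar k u).1 = (planar k v).1 ∧ (planar k u).2 = (planar k v).2 + 1 ∧ (planar k v).2 = rT) ∨
        ((planar k u).1 = (planar k v).1 ∧ (planar k u).2 = (planar k v).2 - 1 ∧ (planar k v).2 = rB)) := by
  obtain ⟨hht, hpa⟩ := adj_out hadj hv hu
  refine ⟨hht, ?_⟩
  rw [mem_boxR_iff] at hv hu
  rcases planarAdj_cases hpa with h | h | h | h <;> omega

/-- **The located surgery of the top-right corner** (widths `n ≥ 4`): every lattice configuration of
`cornerDom₁ ∖ cornerLink₁` admits a surgery for `Q₁` whose cleared set lies inside the corner square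
and inside a ball of radius `3`. [cite: NewmanTassionWu2017, Theorem 3.10 (proof, (3.121)–(3.122)) with Theorem 3.7 (proof, steps (1)–(3))] -/
theorem exists_surgery_corner₁ (hk : 1 ≤ k) (hn : 4 ≤ n) {ω : BondConfig (slab 3 k)}
    (hω : ω ⊆ (slabGraph 3 k).edgeSet) (hX : ω ∈ (cornerQ₁ N n).evX k)
    (hκ : ω ∈ slabConn k (corR N n) {z | z.2 = -(N : ℤ)} {z | z.2 = (N : ℤ) + n}) :
    ∃ sx : (cornerQ₁ N n).Surgery k ω, sx.D ⊆ cornerSq N n 0 ∧ ∃ z : ℤ × ℤ, sx.D ⊆ sqBox z 3 := by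
  set Q := cornerQ₁ N n with hQ
  have hA : ω ∈ Q.evAB k := hX.1
  obtain ⟨hγO, -⟩ := Q.γ_spec hA
  set γ := Q.γ k ω with hγdef
  have hγS : ∀ v ∈ γ, planar k v ∈ domT N n := fun v hv => hγO.subset v hv
  have hγhead : (planar k (γ.head hγO.ne_nil)).1 = -(N : ℤ) := hγO.head_mem hγO.ne_nil
  obtain ⟨κ, hκO⟩ := (mem_slabConn_iff_exists_isOSAP ω _ _ _).1 hκ
  have hκR : ∀ v ∈ κ, planar k v ∈ corR N n := fun v hv => hκO.subset v hv
  have hκhead : (planar k (κ.head hκO.ne_nil)).2 = -(N : ℤ) := hκO.head_mem hκO.ne_nil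
  have hcorR : corR N n ⊆ Q.R := (Set.subset_union_right : corR N n ⊆ domT N n ∪ corR N n)
  -- no vertex lies on both paths
  have hdisj : ∀ v ∈ κ, v ∉ γ := by
    intro v hvκ hvγ
    refine Q.not_joined_of_evX hX (hγO.head_mem hγO.ne_nil) (hκO.head_mem hκO.ne_nil) ?_
    exact SlabCriticality.openConnIn_trans
      (openConnIn_mono (slabLift_mono k Q.hSR) _ _ (hγO.openConnIn_of_mem hvγ))
      (openConnIn_reverse (openConnIn_mono (slabLift_mono k hcorR) _ _ (hκO.openConnIn_of_mem hvκ)))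
  -- (1) the contact and the first vertex of `κ` over a cell of `Γ`
  obtain ⟨g₀, hg₀, x₀, hx₀, hcell₀⟩ := exists_contact_corner₁ (N := N) (by omega) hω hγO hκO
  set Γc : Set (ℤ × ℤ) := {c | ∃ g ∈ γ, planar k g = c} with hΓc
  have hheadΓ : planar k (κ.head hκO.ne_nil) ∉ Γc := by
    rintro ⟨g, hg, hgc⟩
    have h2 := hγS g hg
    rw [hgc] at h2
    simp only [domT, mem_boxR_iff] at h2
    omega
  obtain ⟨m, x, rest, hm, hκeq, hmoff, hxΓ, hedge, -, hmhead, -, -⟩ :=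
    exists_entry (R := corR N n) (D := Γc) hκO.chain hκO.nodup hκO.subset hκO.ne_nil hheadΓ
      ⟨x₀, hx₀, g₀, hg₀, hcell₀⟩
  obtain ⟨g, hgγ, hgx⟩ := hxΓ
  set z := planar k x with hz
  have hzx1 : (planar k x).1 = z.1 := by rw [hz]
  have hzx2 : (planar k x).2 = z.2 := by rw [hz]
  have hxκ : x ∈ κ := by rw [hκeq]; simp
  have hxγ : x ∉ γ := hdisj x hxκ
  have hmκ : ∀ v ∈ m, v ∈ κ := fun v hv => by rw [hκeq]; exact List.mem_append_left _ hv
  have hzb : (N : ℤ) + 1 ≤ z.1 ∧ z.1 ≤ N + n ∧ (N : ℤ) + 1 ≤ z.2 ∧ z.2 ≤ N + n := by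
    have h1 : z ∈ corR N n := hκR x hxκ
    have h2 := hγS g hgγ
    rw [hgx] at h2
    simp only [corR, domT, mem_boxR_iff] at h1 h2
    omega
  -- (2) the cleared box `D = cornerSq ∩ (z + B_3)`
  obtain ⟨xL, hxL1, hxL2, hxL3⟩ : ∃ xL : ℤ, (N : ℤ) + 1 ≤ xL ∧ z.1 - 3 ≤ xL ∧ (xL = N + 1 ∨ xL = z.1 - 3) :=
    ⟨max ((N : ℤ) + 1) (z.1 - 3), le_max_left _ _, le_max_right _ _, max_choice _ _⟩
  obtain ⟨xR, hxR1, hxR2, hxR3⟩ : ∃ xR : ℤ, xR ≤ (N : ℤ) + n ∧ xR ≤ z.1 + 3 ∧ (xR = N + n ∨ xR = z.1 + 3) :=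
    ⟨min ((N : ℤ) + n) (z.1 + 3), min_le_left _ _, min_le_right _ _, min_choice _ _⟩
  obtain ⟨rB, hrB1, hrB2, hrB3⟩ : ∃ rB : ℤ, (N : ℤ) + 1 ≤ rB ∧ z.2 - 3 ≤ rB ∧ (rB = N + 1 ∨ rB = z.2 - 3) :=
    ⟨max ((N : ℤ) + 1) (z.2 - 3), le_max_left _ _, le_max_right _ _, max_choice _ _⟩
  obtain ⟨rT, hrT1, hrT2, hrT3⟩ : ∃ rT : ℤ, rT ≤ (N : ℤ) + n ∧ rT ≤ z.2 + 3 ∧ (rT = N + n ∨ rT = z.2 + 3) :=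
    ⟨min ((N : ℤ) + n) (z.2 + 3), min_le_left _ _, min_le_right _ _, min_choice _ _⟩
  have hcols : xL + 3 ≤ xR := by omega
  have hrows : rB + 3 ≤ rT := by omega
  set D := boxR xL xR rB rT with hDdef
  have hzD : z ∈ D := by rw [hDdef, mem_boxR_iff]; omega
  have hSq : cornerSq N n 0 = boxR ((N : ℤ) + 1) ((N : ℤ) + n) ((N : ℤ) + 1) ((N : ℤ) + n) := by
    simp [cornerSq]
  have hDsq : D ⊆ cornerSq N n 0 := by
    intro w hw; rw [hSq, mem_boxR_iff]; rw [hDdef, mem_boxR_iff] at hw; omega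
  have hDbox : D ⊆ sqBox z 3 := by
    intro w hw
    rw [hDdef, mem_boxR_iff] at hw
    simp only [sqBox, Set.mem_setOf_eq, abs_sub_le_iff]
    push_cast; omega
  have hDS : D ⊆ Q.S := by
    intro w hw; show w ∈ domT N n; rw [hDdef, mem_boxR_iff] at hw; simp only [domT, mem_boxR_iff]; omega
  have hDR : D ⊆ Q.R := hDS.trans Q.hSR
  have hDA : ∀ w ∈ D, w ∉ Q.A := by
    intro w hw hwA; change w.1 = -(N : ℤ) at hwA; rw [hDdef, mem_boxR_iff] at hw; omega
  have hDB : ∀ w ∈ D, w ∉ Q.B := by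
    intro w hw hwB; change w.1 = (N : ℤ) + n + 1 at hwB; rw [hDdef, mem_boxR_iff] at hw; omega
  have hDcor : ∀ w ∈ D, w ∈ corR N n := by
    intro w hw; rw [hDdef, mem_boxR_iff] at hw; simp only [corR, mem_boxR_iff]; omega
  -- (3) two vertices of `Γ` over `D`: `g` and one of its neighbours on `Γ`
  have htwo : ∃ a ∈ γ, ∃ b ∈ γ, a ≠ b ∧ planar k a ∈ D ∧ planar k b ∈ D := by
    have hgD : planar k g ∈ D := by rw [hgx]; exact hzD
    obtain ⟨a, b, hab⟩ := List.append_of_mem hgγ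
    have hch := isChain_adj_of_isChain_open hω hγO.chain
    have hnd := hγO.nodup
    have hb : b ≠ [] := by
      rintro rfl
      have hlast : γ.getLast hγO.ne_nil = g := by simp [hab]
      have := hγO.last_mem hγO.ne_nil
      rw [hlast] at this
      change (planar k g).1 = (N : ℤ) + n + 1 at this
      rw [hgx] at this; omega
    set gp := b.head hb with hgp
    have hgpγ : gp ∈ γ := by rw [hab]; simp [hgp, List.head_mem]
    have hgpadj : (slabGraph 3 k).Adj g gp := by
      have h := hch
      rw [hab, show a ++ g :: b = (a ++ [g]) ++ b by simp] at h
      simpa using List.IsChain.rel_getLast_head_of_append h (by simp) hb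
    have hggp : g ≠ gp := hgpadj.ne
    by_cases hgpD : planar k gp ∈ D
    · exact ⟨g, hgγ, gp, hgpγ, hggp, hgD, hgpD⟩
    -- `gp` is outside: then `z` is on the left column of the square (or `gp` is the end in `B̄`)
    obtain ⟨hhtp, hcp⟩ := outer_nbr hgpadj.symm hgD hgpD
    have hdomp := hγS gp hgpγ
    simp only [domT, mem_boxR_iff] at hdomp
    rw [hgx] at hcp
    -- the predecessor
    have ha : a ≠ [] := by
      rintro rfl
      have : γ.head hγO.ne_nil = g := by simp [hab]
      rw [this, hgx] at hγhead; omega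
    set gm := a.getLast ha with hgm
    have hgmγ : gm ∈ γ := by rw [hab]; exact List.mem_append_left _ (List.getLast_mem ha)
    have hgmadj : (slabGraph 3 k).Adj gm g := by
      have h := hch
      rw [hab] at h
      simpa using List.IsChain.rel_getLast_head_of_append h ha (by simp)
    have hgmg : gm ≠ g := hgmadj.ne
    by_cases hgmD : planar k gm ∈ D
    · exact ⟨gm, hgmγ, g, hgγ, hgmg, hgmD, hgD⟩
    exfalso
    obtain ⟨hhtm, hcm⟩ := outer_nbr hgmadj hgD hgmD
    have hdomm := hγS gm hgmγ
    simp only [domT, mem_boxR_iff] at hdomm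
    rw [hgx] at hcm
    -- `gm` is not the last vertex, hence not in `B̄`
    have hgmB : (planar k gm).1 ≠ (N : ℤ) + n + 1 := by
      intro hB
      have heq := eq_getLast_of_mem_B hA hgmγ (show (planar k gm).1 = (N : ℤ) + n + 1 from hB)
      have hlast : γ.getLast hγO.ne_nil ∈ g :: b := by
        have : γ.getLast hγO.ne_nil = (g :: b).getLast (by simp) := by
          simp [hab, List.getLast_append_of_ne_nil]
        rw [this]; exact List.getLast_mem _
      rw [hab] at hnd
      rw [← heq] at hlast
      exact (List.disjoint_of_nodup_append hnd) (List.getLast_mem ha) hlast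
    -- both outer neighbours lie over `(N, z.2)` at height `ht g`: they coincide, contradiction
    have hsame : gm = gp := by
      rw [slab_ext_iff]
      refine ⟨?_, by rw [hhtm, hhtp]⟩
      ext <;> omega
    rw [hab] at hnd
    have hmem : gm ∈ g :: b := by rw [hsame]; exact List.mem_cons_of_mem _ (List.head_mem hb)
    exact (List.disjoint_of_nodup_append hnd) (List.getLast_mem ha) hmem
  -- the chain, nodup and region facts of the prefix `m`
  have hmch : m.IsChain (fun a b => s(a, b) ∈ ω ∧ a ≠ b) := by
    have h := hκO.chain; rw [hκeq] at h; exact h.left_of_append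
  have hmnd : m.Nodup := by
    have h := hκO.nodup; rw [hκeq] at h; exact h.of_append_left
  have hmsub : ∀ v ∈ m, v ∈ slabLift k (corR N n) := fun v hv => hκR v (hmκ v hv)
  have hmheadD : planar k (m.head hm) ∉ D := by
    rw [hmhead, hDdef, mem_boxR_iff]; omega
  have hcC : κ.head hκO.ne_nil ∈ slabLift k Q.C := hκO.head_mem hκO.ne_nil
  have hsubRD : slabLift k (corR N n \ D) ⊆ slabLift k (Q.R \ D) :=
    slabLift_mono k (Set.sdiff_subset_sdiff_left hcorR)
  have hfin : ∀ {sx : Q.Surgery k ω}, sx.D = D →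
      ∃ sx : (cornerQ₁ N n).Surgery k ω, sx.D ⊆ cornerSq N n 0 ∧ ∃ z : ℤ × ℤ, sx.D ⊆ sqBox z 3 :=
    fun {sx} hsx => ⟨sx, hsx ▸ hDsq, z, hsx ▸ hDbox⟩
  by_cases hmD : ∃ v ∈ m, planar k v ∈ D
  · /- CASE A: `κ` enters `D̄` before reaching a cell of `Γ`; the entry vertex is on no cell of `Γ`,
       so the tree's routing theorem applies. -/
    obtain ⟨m', w', rest', hm', hmeq, hm'off, hw'D, hedge', -, hm'head, hconn', -⟩ :=
      exists_entry (R := corR N n) (D := D) hmch hmnd hmsub hm hmheadD hmD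
    have hw'm : w' ∈ m := by rw [hmeq]; simp
    have hw'Γ : planar k w' ∉ Γc := hmoff w' hw'm
    have hq₁D : planar k (m'.getLast hm') ∉ D := hm'off _ (List.getLast_mem hm')
    have hadj : (slabGraph 3 k).Adj w' (m'.getLast hm') := ((SimpleGraph.mem_edgeSet _).1 (hω hedge')).symm
    have hσ : ω ∈ openConnIn (slabLift k (Q.R \ D)) (m'.getLast hm') (κ.head hκO.ne_nil) := by
      rw [← hmhead]
      exact openConnIn_reverse (openConnIn_mono hsubRD _ _ hconn')
    obtain ⟨sx, hsx⟩ := exists_surgery_of_route hX hDR hDA hDB subset_rfl hDS htwo hadj hq₁D hcC hσ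
      (fun E₁ E₂ hE₁ hE₂ hne hE₁D hE₂D =>
        exists_route hk (by omega) le_rfl hrows le_rfl hE₁D hE₂D hw'D hne
          (fun h => hw'Γ ⟨E₁, hE₁, h⟩) (fun h => hw'Γ ⟨E₂, hE₂, h⟩))
    exact hfin hsx
  · /- CASE B: `κ` reaches the cell `z` of `Γ` from outside `D̄`, i.e. from below the corner square. -/
    push Not at hmD
    set q₁ := m.getLast hm with hq₁
    have hq₁m : q₁ ∈ m := List.getLast_mem hm
    have hq₁D : planar k q₁ ∉ D := hmD q₁ hq₁m
    have hadj : (slabGraph 3 k).Adj x q₁ := ((SimpleGraph.mem_edgeSet _).1 (hω hedge)).symm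
    have hσ : ω ∈ openConnIn (slabLift k (Q.R \ D)) q₁ (κ.head hκO.ne_nil) := by
      obtain ⟨m₀, mt, hm₀⟩ := List.exists_cons_of_ne_nil hm
      have hsub' : ∀ v ∈ m₀ :: mt, v ∈ slabLift k (corR N n \ D) := fun v hv =>
        ⟨hmsub v (hm₀ ▸ hv), hmD v (hm₀ ▸ hv)⟩
      have h := openConnIn_of_isChain m₀ mt (hm₀ ▸ hmch) hsub'
      have hh : (m₀ :: mt).getLast (List.cons_ne_nil _ _) = q₁ := by simp [hq₁, hm₀]
      have hh' : m₀ = κ.head hκO.ne_nil := by rw [← hmhead]; simp [hm₀]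
      rw [hh, hh'] at h
      exact openConnIn_reverse (openConnIn_mono hsubRD _ _ h)
    -- where the port is: below `z`, and `z` on the bottom row of the square
    obtain ⟨-, hqc⟩ := outer_nbr hadj.symm (show planar k x ∈ D from hzD) hq₁D
    have hq₁cor := hκR q₁ (hmκ q₁ hq₁m)
    simp only [corR, mem_boxR_iff] at hq₁cor
    rw [hDdef, mem_boxR_iff] at hq₁D
    have hzrow : z.2 = (N : ℤ) + 1 ∧ rB = (N : ℤ) + 1 := by omega
    have hxz : planar k x = (z.1, rB) := by ext <;> simp only <;> omega
    refine hfin (Classical.choose_spec (exists_surgery_of_route' hω hX hDR hDA hDB subset_rfl hDS htwo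
      hadj hq₁D hcC hσ ?_))
    intro E₁ E₂ pE sE hE₁ hE₂ hne hE₁D hE₂D hpEγ hpEadj hpED hpEB hsEγ hsEadj hsED
    have hE₁x : E₁ ≠ x := fun h => hxγ (h ▸ hE₁)
    have hE₂x : E₂ ≠ x := fun h => hxγ (h ▸ hE₂)
    have hpEdom := hγS pE hpEγ
    have hsEdom := hγS sE hsEγ
    simp only [domT, mem_boxR_iff] at hpEdom hsEdom
    change (planar k pE).1 ≠ (N : ℤ) + n + 1 at hpEB
    have hE₁D' := hE₁D; have hE₂D' := hE₂D
    rw [hDdef, mem_boxR_iff] at hE₁D' hE₂D'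
    by_cases h1 : planar k E₁ = z
    · -- `E₁` over `z`: its predecessor is off `D̄`, in `domT`, not in `B̄` ⇒ `z = (N+1, N+1) = (xL, rB)`
      obtain ⟨hhtp, hpc⟩ := outer_nbr hpEadj hE₁D hpED
      rw [h1] at hpc
      have hcorner : z.1 = (N : ℤ) + 1 ∧ xL = z.1 := by omega
      have hE₁z : planar k E₁ = (xL, rB) := by rw [h1]; ext <;> simp [hcorner, hzrow]
      have hxz' : planar k x = (xL, rB) := by rw [hxz]; ext <;> simp [hcorner]
      by_cases h2 : planar k E₂ = z
      · have hE₂z : planar k E₂ = (xL, rB) := by rw [h2]; ext <;> simp [hcorner, hzrow]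
        exact route_cornerBL_both hk hcols hrows hE₁z hE₂z hxz' hne hE₁x hE₂x
      · by_cases h3 : planar k E₂ = (xL, rB + 1) ∧ ht E₂ = ht E₁
        · exact route_cornerBL_fst' hk hcols hrows hE₁z hxz' hE₁x h3.1 h3.2
        · have h2' : planar k E₂ ≠ (xL, rB) := by rw [← hE₁z, h1]; exact h2
          -- `E₂` is a last vertex over `D`: its successor is off `D̄` and in `domT`
          obtain ⟨hhts, hsc⟩ := outer_nbr hsEadj.symm hE₂D hsED
          have hE₂b : planar k E₂ ≠ (xL + 1, rB) := by
            intro h; rw [h] at hsc; simp only at hsc; omega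
          have hE₂c : planar k E₂ ≠ (xL + 1, rB + 1) := by
            intro h; rw [h] at hsc; simp only at hsc; omega
          have hE₂d : E₂ ≠ vtx k (xL, rB + 1) (ht E₁) := by
            intro h; apply h3
            rw [h, planar_vtx, ht_vtx (ht_le E₁)]; exact ⟨rfl, rfl⟩
          exact route_cornerBL_fst hk hcols hrows hE₁z hxz' hE₁x hE₂D h2' hE₂b hE₂c hE₂d hE₂x
    · by_cases h2 : planar k E₂ = z
      · -- `E₂` over `z`: its successor is off `D̄` in `domT` ⇒ `z` is a bottom corner of the square
        obtain ⟨hhts, hsc⟩ := outer_nbr hsEadj.symm hE₂D hsED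
        rw [h2] at hsc
        have hcorner : (z.1 = (N : ℤ) + 1 ∧ xL = z.1) ∨ (z.1 = (N : ℤ) + n ∧ xR = z.1) := by omega
        -- `E₁` is a first vertex over `D`: its predecessor is off `D̄`, in `domT`, not in `B̄`
        obtain ⟨hhtp, hpc⟩ := outer_nbr hpEadj hE₁D hpED
        rcases hcorner with hc | hc
        · -- bottom-left corner
          have hE₂z : planar k E₂ = (xL, rB) := by rw [h2]; ext <;> simp [hc, hzrow]
          have hxz' : planar k x = (xL, rB) := by rw [hxz]; ext <;> simp [hc]
          by_cases h3 : planar k E₁ = (xL, rB + 1) ∧ ht E₁ = ht E₂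
          · exact route_cornerBL_snd' hk hcols hrows hE₂z hxz' hE₂x h3.1 h3.2
          · have h1' : planar k E₁ ≠ (xL, rB) := by rw [← hE₂z, h2]; exact h1
            have hE₁b : planar k E₁ ≠ (xL + 1, rB) := by
              intro h; rw [h] at hpc; simp only at hpc; omega
            have hE₁c : planar k E₁ ≠ (xL + 1, rB + 1) := by
              intro h; rw [h] at hpc; simp only at hpc; omega
            have hE₁d : E₁ ≠ vtx k (xL, rB + 1) (ht E₂) := by
              intro h; apply h3
              rw [h, planar_vtx, ht_vtx (ht_le E₂)]; exact ⟨rfl, rfl⟩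
            exact route_cornerBL_snd hk hcols hrows hE₂z hxz' hE₂x hE₁D h1' hE₁b hE₁c hE₁d hE₁x
        · -- bottom-right corner
          have hE₂z : planar k E₂ = (xR, rB) := by rw [h2]; ext <;> simp [hc, hzrow]
          have hxz' : planar k x = (xR, rB) := by rw [hxz]; ext <;> simp [hc]
          have h1' : planar k E₁ ≠ (xR, rB) := by rw [← hE₂z, h2]; exact h1
          have hE₁b : planar k E₁ ≠ (xR - 1, rB) := by
            intro h; rw [h] at hpc; simp only at hpc; omega
          have hE₁c : planar k E₁ ≠ (xR - 1, rB + 1) := by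
            intro h; rw [h] at hpc; simp only at hpc; omega
          have hE₁d : E₁ ≠ vtx k (xR, rB + 1) (ht E₂) := by
            intro h; rw [h, planar_vtx] at hpc; simp only at hpc; omega
          have hE₁top : (planar k E₁).1 = xR → (planar k E₁).2 = rT := by intro h; omega
          exact route_cornerBR_snd hk hcols hrows hE₂z hxz' hE₂x hE₁D h1' hE₁b hE₁c hE₁d hE₁x hE₁top
      · -- generic position: the tree's routing theorem
        exact exists_route hk (by omega) le_rfl hrows le_rfl hE₁D hE₂D (show planar k x ∈ D from hzD) hne
          h1 h2

end Corner

end NTW17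

end Literature.Probability.Percolation

end
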